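import Literature.NumberTheory.EllipticCurves.TwoIsogenyDescentIndex
import Literature.NumberTheory.EllipticCurves.IsogenyLocalPointsMaps
import HarnessLib

/-!
# The dual `ψ : E₂ → E₁` of Silverman's explicit `2`-isogeny, as a NAMED map on points
# (Silverman–Tate, *Rational Points on Elliptic Curves*, §3.4 Prop. 3.7; Silverman, *AEC*, III.4.5, III.6.1)

(p2-monsky-lit GEN 8, W2 item K3′ of p2-lead ML-51/ML-56; definitions + proved API, NO named fact, nothing about
BSD or about Tian–Yuan–Zhang's theorems is asserted here.) The tree packages the dual
isogeny on `F`-points only as an existence statement (`WeierstrassCurve.exists_twoIsogenyDualHom`: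
`∃ ψ`, `ψ ∘ φ = [2]`, `ker ψ = {Ō, T̄}`, `ker α = ψ(E₂(F))`). Tian–Yuan–Zhang's genus-point statements
(Asian J. Math. 21 (2017), §3.1: Thm 3.5, Prop 3.4, Lemma 3.21 — the W2 displays F1–F4 of p2-lit-1)
speak of the VALUES of TYZ's `2`-isogeny `φ : A → E` (which is this `ψ`, `A ≅ E₂`) on points over
number fields and of their behaviour under Galois automorphisms and base change; an anonymous `∃ ψ`
cannot carry these. This file therefore NAMES the dual, by its printed formula
`ψ(x̄, ȳ) = (ȳ²/4x̄², ȳ(x̄² − b̄)/8x̄²)` (Silverman–Tate §3.4: `φ̄ : C̄ → C̿` followed by `(x, y) ↦ (x/4, y/8)`),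
and PROVES: it is the function underlying `exists_twoIsogenyDualHom`'s construction
(`twoIsogenyDualFun_eq`), hence additive with `ψ ∘ φ = [2]`, `ker ψ = {Ō, T̄}`, `ker α = range ψ`;
over any extension `L ⊇ K` (`twoIsogenyDualPointsFun`) it commutes with the maps on points induced by
`K`-algebra homomorphisms (`map_twoIsogenyDualPointsFun`, the analogue of the tree's
`map_twoIsogenyPointsHom` for `φ`), in particular with `Gal(L/K)` and with base change from `K`.

## Design (the `DecidableEq` diamond)

Mathlib's group law on `W.toAffine.Point` takes a `[DecidableEq F]` argument; the tree's general-field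
files (this one included) elaborate it classically, whereas files working over `ℚ` pick `Rat`'s
instance. All MAPS here are therefore plain FUNCTIONS (instance-free types); the bundled homomorphism
`twoIsogenyDualHomOf` and the group-law lemmas `…_add'`, `…_twoIsogenyFun'` take the AMBIENT
instance `[d : DecidableEq F]` and are proved by `subst (Subsingleton.elim d (Classical.decEq F))` from
the classical versions, so that they apply verbatim in `ℚ`-files.

## References
* J. H. Silverman, J. T. Tate, *Rational Points on Elliptic Curves*, 2nd ed. (2015), §3.4 Prop. 3.7
  (`ψ`, `ψ ∘ φ = [2]`, `ker`), §3.5 Prop. 3.8(b) (`ker α = ψ(Γ̄)`). [SilvermanTate2015]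
* J. H. Silverman, *The Arithmetic of Elliptic Curves*, 2nd ed., III.4.5, III.6.1, VIII.§1 (Galois
  action on points). [SilvermanAEC2009]
* Y. Tian, X. Yuan, S.-W. Zhang, Asian J. Math. 21 (2017), §1 (the isogeny `φ_n : A_n → E_n`,
  p0002 L101–L110), §3.1. [TianYuanZhang2017]
-/

noncomputable section

open scoped Classical

namespace WeierstrassCurve

open WeierstrassCurve.Affine (sqClass sqClass_mul sqClass_sq sqClass_eq_one_iff)

universe u v w

section Field

variable {F : Type u} [Field F] (W : WeierstrassCurve F) [W.IsTwoTorsionNF] [W.IsElliptic]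

/-! ### The dual on `F`-points, by its formula -/

/-- The abscissa `X(φ₂(x̄, ȳ))/4 = ȳ²/(4x̄²)` of `ψ(x̄, ȳ)`. [cite: SilvermanTate2015, §3.4 Prop. 3.7(b)] -/
def twoIsogenyDualX (X : F) : F :=
  W.twoIsogenyCodomain.twoIsogenyX X / 4

/-- The ordinate `Y(φ₂(x̄, ȳ))/8 = ȳ(x̄² − b̄)/(8x̄²)` of `ψ(x̄, ȳ)`. [cite: SilvermanTate2015, §3.4 Prop. 3.7(b)] -/
def twoIsogenyDualY (X Y : F) : F :=
  W.twoIsogenyCodomain.twoIsogenyY X Y / 8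

/-- `4 ≠ 0` in `F` (the curve is elliptic in two-torsion normal form, so `char F ≠ 2`). [folklore] -/
private theorem four_ne_zero' (V : WeierstrassCurve F) [V.IsTwoTorsionNF] [V.IsElliptic] : (4 : F) ≠ 0 := by
  rw [show (4 : F) = 2 * 2 by norm_num]; exact mul_ne_zero (two_ne_zero' V) (two_ne_zero' V)

/-- `8 ≠ 0` in `F`. [folklore] -/
private theorem eight_ne_zero' (V : WeierstrassCurve F) [V.IsTwoTorsionNF] [V.IsElliptic] : (8 : F) ≠ 0 := by
  rw [show (8 : F) = 2 * 4 by norm_num]; exact mul_ne_zero (two_ne_zero' V) (four_ne_zero' V)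

/-- `ψ(x̄, ȳ)` lies on `E₁` (it is `(X/4, Y/8)` for the point `(X, Y) = φ₂(x̄, ȳ)` of `E₃`). [cite: SilvermanTate2015, §3.4 Prop. 3.7(b)] -/
theorem nonsingular_twoIsogenyDual {X Y : F} (h : W.twoIsogenyCodomain.toAffine.Equation X Y)
    (hX : X ≠ 0) : W.toAffine.Nonsingular (W.twoIsogenyDualX X) (W.twoIsogenyDualY X Y) := by
  have hE := equation_twoIsogeny W.twoIsogenyCodomain h hX
  refine Affine.equation_iff_nonsingular.mp ((W.equation_scale_iff _ _ (two_ne_zero' W)).mp ?_)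
  rwa [twoIsogenyDualX, twoIsogenyDualY, mul_div_cancel₀ _ (four_ne_zero' W),
    mul_div_cancel₀ _ (eight_ne_zero' W)]

/-- **The dual `ψ : E₂(F) → E₁(F)` as a function**: `Ō ↦ O`, `T̄ = (0,0) ↦ O`,
`(x̄, ȳ) ↦ (ȳ²/4x̄², ȳ(x̄² − b̄)/8x̄²)`. [cite: SilvermanTate2015, §3.4 Prop. 3.7(b)] -/
def twoIsogenyDualFun : W.twoIsogenyCodomain.toAffine.Point → W.toAffine.Point
  | 0 => 0
  | .some X Y h =>
    if hX : X = 0 then 0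
    else .some (W.twoIsogenyDualX X) (W.twoIsogenyDualY X Y) (W.nonsingular_twoIsogenyDual h.left hX)

/-- `ψ(Ō) = O`. [cite: SilvermanTate2015, §3.4 Prop. 3.7(b)] -/
@[simp]
theorem twoIsogenyDualFun_zero : W.twoIsogenyDualFun 0 = 0 :=
  rfl

/-- `ψ(T̄) = O` (any affine point with `x̄ = 0`). [cite: SilvermanTate2015, §3.4 Prop. 3.7] -/
theorem twoIsogenyDualFun_some_of_eq_zero {X Y : F} (h : W.twoIsogenyCodomain.toAffine.Nonsingular X Y)
    (hX : X = 0) : W.twoIsogenyDualFun (.some X Y h) = 0 := by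
  subst hX
  simp [twoIsogenyDualFun]

/-- `ψ(x̄, ȳ) = (ȳ²/4x̄², ȳ(x̄² − b̄)/8x̄²)` for `x̄ ≠ 0`. [cite: SilvermanTate2015, §3.4 Prop. 3.7(b)] -/
theorem twoIsogenyDualFun_some {X Y : F} (h : W.twoIsogenyCodomain.toAffine.Nonsingular X Y)
    (hX : X ≠ 0) :
    W.twoIsogenyDualFun (.some X Y h) = .some _ _ (W.nonsingular_twoIsogenyDual h.left hX) := by
  simp [twoIsogenyDualFun, hX]

/-! ### `ψ` is the map packaged by `exists_twoIsogenyDualHom`: the scaling `E₃(F) ≃ E₁(F)` -/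

/-- The isomorphism `E₃(F) ≃+ E₁(F)`, `(X, Y) ↦ (X/4, Y/8)` (the change of variables `(2; 0, 0, 0)`,
`two_smul_twoIsogenyCodomain_twoIsogenyCodomain`). [cite: SilvermanTate2015, §3.4 Prop. 3.7(b)] -/
def twoIsogenyScaling : W.twoIsogenyCodomain.twoIsogenyCodomain.toAffine.Point ≃+ W.toAffine.Point :=
  (VariableChange.pointEquiv W.twoIsogenyCodomain.twoIsogenyCodomain
      ⟨Units.mk0 (2 : F) (two_ne_zero' W), 0, 0, 0⟩).trans
    (Affine.Point.congrEquiv (two_smul_twoIsogenyCodomain_twoIsogenyCodomain W))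

/-- The scaling sends `(4x, 8y)` to `(x, y)` (the map `(x, y) ↦ (x/4, y/8)` of `C̿ ≅ C`). [cite: SilvermanTate2015, §3.4 Prop. 3.7(b)] -/
theorem twoIsogenyScaling_some {x y : F} (h : W.toAffine.Nonsingular x y) :
    W.twoIsogenyScaling (.some (4 * x) (8 * y) (W.nonsingular_scale h)) = .some x y h := by
  simp only [twoIsogenyScaling, AddEquiv.trans_apply, VariableChange.pointEquiv_some,
    Affine.Point.congrEquiv_some, Affine.Point.some.injEq]
  simp only [VariableChange.toX_def, VariableChange.toY_def, Units.val_inv_eq_inv_val,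
    Units.val_mk0, sub_zero, zero_mul]
  have h2 : (2 : F) ≠ 0 := two_ne_zero' W
  have h4 := four_ne_zero' W
  have h8 := eight_ne_zero' W
  constructor
  · field_simp; ring
  · field_simp; ring

/-- `ψ = (scaling) ∘ φ₂` pointwise. [cite: SilvermanTate2015, §3.4 Prop. 3.7(b)] -/
theorem twoIsogenyDualFun_eq (Q : W.twoIsogenyCodomain.toAffine.Point) :
    W.twoIsogenyDualFun Q = W.twoIsogenyScaling (W.twoIsogenyCodomain.twoIsogenyFun Q) := by
  rcases Q with _ | ⟨X, Y, h⟩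
  · change W.twoIsogenyDualFun 0 = W.twoIsogenyScaling (W.twoIsogenyCodomain.twoIsogenyFun 0)
    rw [twoIsogenyDualFun_zero, twoIsogenyFun_zero, map_zero]
  · by_cases hX : X = 0
    · rw [twoIsogenyDualFun_some_of_eq_zero W h hX, twoIsogenyFun_some_of_eq_zero _ h hX, map_zero]
    · rw [twoIsogenyDualFun_some W h hX, twoIsogenyFun_some _ h hX]
      have h4 := four_ne_zero' W
      have h8 := eight_ne_zero' W
      obtain ⟨h', e⟩ := some_eq_some_of_eq (nonsingular_twoIsogeny _ h.left hX)
        (show W.twoIsogenyCodomain.twoIsogenyX X = 4 * W.twoIsogenyDualX X by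
          rw [twoIsogenyDualX, mul_div_cancel₀ _ h4])
        (show W.twoIsogenyCodomain.twoIsogenyY X Y = 8 * W.twoIsogenyDualY X Y by
          rw [twoIsogenyDualY, mul_div_cancel₀ _ h8])
      rw [e, twoIsogenyScaling_some]

/-- `ψ` is additive (classical instance; see `twoIsogenyDualFun_add'` for the ambient one).
[cite: SilvermanTate2015, §3.4 Prop. 3.7] -/
theorem twoIsogenyDualFun_add (P Q : W.twoIsogenyCodomain.toAffine.Point) :
    W.twoIsogenyDualFun (P + Q) = W.twoIsogenyDualFun P + W.twoIsogenyDualFun Q := by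
  simp only [twoIsogenyDualFun_eq, ← twoIsogenyHom_apply, map_add]

/-- **`ψ ∘ φ = [2]`** (classical instance; see `…'`). [cite: SilvermanTate2015, §3.4 Prop. 3.7(c)] -/
theorem twoIsogenyDualFun_twoIsogenyFun (P : W.toAffine.Point) :
    W.twoIsogenyDualFun (W.twoIsogenyFun P) = 2 • P := by
  rw [twoIsogenyDualFun_eq]
  rcases twoIsogenyFun_twoIsogenyFun W P with ⟨hP, h0⟩ | ⟨x', y', h', hP, he⟩
  · rw [h0, hP, map_zero]
  · rw [he, hP, twoIsogenyScaling_some]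

/-- **`ker ψ = {Ō, T̄}`**. [cite: SilvermanTate2015, §3.4 Prop. 3.7(a)] -/
theorem twoIsogenyDualFun_eq_zero_iff (Q : W.twoIsogenyCodomain.toAffine.Point) :
    W.twoIsogenyDualFun Q = 0 ↔ Q = 0 ∨ Q = W.twoIsogenyCodomain.twoTorsionPoint := by
  rw [twoIsogenyDualFun_eq, EmbeddingLike.map_eq_zero_iff, ← twoIsogenyHom_apply,
    twoIsogenyHom_eq_zero_iff]

/-- The scaling preserves `α`: `α₁(X/4, Y/8) = α₃(X, Y)` (`X/4 ≡ X` mod squares). [cite: SilvermanTate2015, §3.5 Prop. 3.8(b)] -/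
theorem xSqClass_twoIsogenyScaling (R : W.twoIsogenyCodomain.twoIsogenyCodomain.toAffine.Point) :
    W.xSqClass (W.twoIsogenyScaling R) = W.twoIsogenyCodomain.twoIsogenyCodomain.xSqClass R := by
  have hb := a₄_ne_zero W
  have h2 : (2 : F) ≠ 0 := two_ne_zero' W
  have h4 := four_ne_zero' W
  rcases W.eq_zero_or_exists_eq_scale R with rfl | ⟨x, y, h, rfl⟩
  · rw [map_zero]; rfl
  · rw [twoIsogenyScaling_some W h]
    by_cases hx : x = 0
    · rw [xSqClass_some_of_eq_zero _ hx, xSqClass_some_of_eq_zero _ (by rw [hx, mul_zero]),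
        twoIsogenyCodomain_a₄, twoIsogenyCodomain_a₂, twoIsogenyCodomain_a₄]
      rw [show (-2 * W.a₂) ^ 2 - 4 * (W.a₂ ^ 2 - 4 * W.a₄) = 4 ^ 2 * W.a₄ by ring,
        sqClass_mul (pow_ne_zero 2 h4) hb, sqClass_sq, Affine.SqUnits.one_mul]
    · rw [xSqClass_some_of_ne_zero _ hx, xSqClass_some_of_ne_zero _ (mul_ne_zero h4 hx),
        show (4 : F) * x = 2 ^ 2 * x by norm_num, sqClass_mul (pow_ne_zero 2 h2) hx, sqClass_sq,
        Affine.SqUnits.one_mul]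

/-- **`ker α = ψ(E₂(F))`**: `α(P) = 1 ↔ P = ψ(Q)` for some `F`-point `Q` of `E₂`.
[cite: SilvermanTate2015, §3.5 Prop. 3.8(b)] -/
theorem xSqClass_eq_one_iff_exists_twoIsogenyDualFun (P : W.toAffine.Point) :
    W.xSqClass P = 1 ↔ ∃ Q, W.twoIsogenyDualFun Q = P := by
  have key := W.twoIsogenyCodomain.xSqClass_eq_one_iff_exists (W.twoIsogenyScaling.symm P)
  rw [← xSqClass_twoIsogenyScaling, AddEquiv.apply_symm_apply] at key
  rw [key]
  constructor
  · rintro ⟨Q, hQ⟩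
    exact ⟨Q, by rw [twoIsogenyDualFun_eq, hQ, AddEquiv.apply_symm_apply]⟩
  · rintro ⟨Q, rfl⟩
    exact ⟨Q, by rw [twoIsogenyDualFun_eq, AddEquiv.symm_apply_apply]⟩

/-! ### The ambient-instance versions (for `ℚ`-files) -/

/-- `ψ` is additive, at any `DecidableEq` instance. [cite: SilvermanTate2015, §3.4 Prop. 3.7] -/
theorem twoIsogenyDualFun_add' [d : DecidableEq F] (P Q : W.twoIsogenyCodomain.toAffine.Point) :
    W.twoIsogenyDualFun (P + Q) = W.twoIsogenyDualFun P + W.twoIsogenyDualFun Q := by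
  have e : d = Classical.decEq F := Subsingleton.elim _ _
  subst e
  exact W.twoIsogenyDualFun_add P Q

/-- `ψ ∘ φ = [2]`, at any `DecidableEq` instance. [cite: SilvermanTate2015, §3.4 Prop. 3.7(c)] -/
theorem twoIsogenyDualFun_twoIsogenyFun' [d : DecidableEq F] (P : W.toAffine.Point) : W.twoIsogenyDualFun (W.twoIsogenyFun P) = 2 • P := by
  have e : d = Classical.decEq F := Subsingleton.elim _ _
  subst e
  exact W.twoIsogenyDualFun_twoIsogenyFun P

/-- **The dual as a homomorphism `ψ : E₂(F) →+ E₁(F)`** at the ambient `DecidableEq` instance.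
[cite: SilvermanTate2015, §3.4 Prop. 3.7] -/
def twoIsogenyDualHomOf [DecidableEq F] :
    W.twoIsogenyCodomain.toAffine.Point →+ W.toAffine.Point where
  toFun := W.twoIsogenyDualFun
  map_zero' := rfl
  map_add' := W.twoIsogenyDualFun_add'

/-- `twoIsogenyDualHomOf` is `twoIsogenyDualFun` as a function (the formula of the dual). [cite: SilvermanTate2015, §3.4 Prop. 3.7(b)] -/
@[simp]
theorem twoIsogenyDualHomOf_apply [DecidableEq F] (Q : W.twoIsogenyCodomain.toAffine.Point) : W.twoIsogenyDualHomOf Q = W.twoIsogenyDualFun Q :=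
  rfl

end Field

/-! ### Over extension fields: `ψ_L : E₂(L) → E₁(L)` and its functoriality in `L` -/

section Extension

variable {K : Type u} [Field K] (W : WeierstrassCurve K) [W.IsTwoTorsionNF] [W.IsElliptic]

/-- Transport along an equality and back is the identity. [folklore] -/
private theorem Affine.Point.congrEquiv_symm_apply_apply {F : Type u} [Field F] {W₁ W₂ : WeierstrassCurve F}
    (h : W₁ = W₂) (x : W₁.toAffine.Point) :
    Affine.Point.congrEquiv h.symm (Affine.Point.congrEquiv h x) = x := by
  subst h; rfl

/-- **The dual on `L`-points**, `L ⊇ K`: `E₂(L) → E₁(L)` with `E₂ = W.twoIsogenyCodomain` (the same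
formula, coefficients read in `L`). [cite: SilvermanTate2015, §3.4 Prop. 3.7(b)] -/
def twoIsogenyDualPointsFun (L : Type v) [Field L] [Algebra K L] :
    (W.twoIsogenyCodomain.baseChange L).toAffine.Point → (W.baseChange L).toAffine.Point :=
  fun Q => (W.baseChange L).twoIsogenyDualFun
    (Affine.Point.congrEquiv (twoIsogenyCodomain_baseChange W L).symm Q)

/-- `ψ_L(Ō) = O`. [cite: SilvermanTate2015, §3.4 Prop. 3.7(b)] -/
@[simp]
theorem twoIsogenyDualPointsFun_zero (L : Type v) [Field L] [Algebra K L] :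
    W.twoIsogenyDualPointsFun L 0 = 0 := by
  simp [twoIsogenyDualPointsFun, Affine.Point.congrEquiv_zero]

/-- `ψ_L` on an affine point with `x̄ = 0` (i.e. on `T̄`): `O`. [cite: SilvermanTate2015, §3.4 Prop. 3.7(b)] -/
theorem twoIsogenyDualPointsFun_some_of_eq_zero {L : Type v} [Field L] [Algebra K L] {X Y : L}
    (h : (W.twoIsogenyCodomain.baseChange L).toAffine.Nonsingular X Y) (hX : X = 0) :
    W.twoIsogenyDualPointsFun L (.some X Y h) = 0 := by
  simp [twoIsogenyDualPointsFun, Affine.Point.congrEquiv_some, twoIsogenyDualFun_some_of_eq_zero _ _ hX]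

/-- `ψ_L` on an affine point with `x̄ ≠ 0`: the formula with coefficients in `L`. [cite: SilvermanTate2015, §3.4 Prop. 3.7(b)] -/
theorem twoIsogenyDualPointsFun_some {L : Type v} [Field L] [Algebra K L] {X Y : L}
    (h : (W.twoIsogenyCodomain.baseChange L).toAffine.Nonsingular X Y) (hX : X ≠ 0) :
    ∃ h', W.twoIsogenyDualPointsFun L (.some X Y h) =
      .some ((W.baseChange L).twoIsogenyDualX X) ((W.baseChange L).twoIsogenyDualY X Y) h' := by
  refine ⟨(W.baseChange L).nonsingular_twoIsogenyDual
    ((twoIsogenyCodomain_baseChange W L).symm ▸ h).left hX, ?_⟩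
  simp [twoIsogenyDualPointsFun, Affine.Point.congrEquiv_some, twoIsogenyDualFun_some _ _ hX]

/-- Over the base field itself, `ψ_K` is `ψ` (`W.baseChange K` is `W`). [cite: SilvermanTate2015, §3.4 Prop. 3.7(b)] -/
theorem twoIsogenyDualPointsFun_base (Q : W.twoIsogenyCodomain.toAffine.Point) :
    W.twoIsogenyDualPointsFun K Q = W.twoIsogenyDualFun Q := by
  rcases Q with _ | ⟨X, Y, h⟩
  · rfl
  · by_cases hX : X = 0
    · rw [twoIsogenyDualFun_some_of_eq_zero W h hX]
      exact twoIsogenyDualPointsFun_some_of_eq_zero W h hX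
    · obtain ⟨h', e⟩ := twoIsogenyDualPointsFun_some W (L := K) h hX
      rw [twoIsogenyDualFun_some W h hX]
      exact e

/-- **`ψ` commutes with the maps on points induced by `K`-algebra homomorphisms** `f : L → L'`
(its formula has coefficients in `K`): `f_* ∘ ψ_L = ψ_{L'} ∘ f_*`. In particular `ψ` commutes with
`Gal(L/K)` and with base change (an isogeny defined over `K` commutes with `Gal(K̄/K)`). [cite: SilvermanAEC2009, III.4.5 and VIII.§1] -/
theorem map_twoIsogenyDualPointsFun {L : Type v} [Field L] [Algebra K L] {L' : Type w} [Field L']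
    [Algebra K L'] (f : L →ₐ[K] L') (Q : (W.twoIsogenyCodomain.baseChange L).toAffine.Point) :
    Affine.Point.map f (W.twoIsogenyDualPointsFun L Q) =
      W.twoIsogenyDualPointsFun L' (Affine.Point.map f Q) := by
  rcases Q with _ | ⟨X, Y, h⟩
  · simp only [← Affine.Point.zero_def, Affine.Point.map_zero, twoIsogenyDualPointsFun_zero]
  · by_cases hX : X = 0
    · rw [twoIsogenyDualPointsFun_some_of_eq_zero W h hX, Affine.Point.map_zero, Affine.Point.map_some,
        twoIsogenyDualPointsFun_some_of_eq_zero W _ (by rw [hX, map_zero])]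
    · obtain ⟨h₁, e₁⟩ := twoIsogenyDualPointsFun_some W h hX
      have hfX : f X ≠ 0 := (map_ne_zero f).mpr hX
      obtain ⟨h₂, e₂⟩ := twoIsogenyDualPointsFun_some W (L := L')
        ((Affine.baseChange_nonsingular (W := W.twoIsogenyCodomain) f.injective X Y).mpr h) hfX
      rw [e₁, Affine.Point.map_some, Affine.Point.map_some, e₂]
      congr 1
      · simp only [twoIsogenyDualX, twoIsogenyX, map_div₀, map_add, map_mul, map_pow, baseChange,
          map_a₂, map_a₄, twoIsogenyCodomain_a₂, twoIsogenyCodomain_a₄, map_neg, map_sub,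
          map_ofNat, AlgHom.commutes]
      · simp only [twoIsogenyDualY, twoIsogenyY, map_div₀, map_sub, map_mul, map_pow, baseChange,
          map_a₂, map_a₄, twoIsogenyCodomain_a₄, map_ofNat, AlgHom.commutes]

/-- `ψ_L ∘ φ_L = [2]` on `E₁(L)`, with `φ_L = twoIsogenyPointsHom W L` (at any `DecidableEq L`).
[cite: SilvermanTate2015, §3.4 Prop. 3.7(c)] -/
theorem twoIsogenyDualPointsFun_twoIsogenyPointsHom {L : Type v} [Field L] [Algebra K L]
    [d : DecidableEq L] (P : (W.baseChange L).toAffine.Point) :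
    W.twoIsogenyDualPointsFun L (W.twoIsogenyPointsHom L P) = 2 • P := by
  have e : d = Classical.decEq L := Subsingleton.elim _ _
  subst e
  simp only [twoIsogenyDualPointsFun, twoIsogenyPointsHom, AddMonoidHom.coe_comp,
    AddEquiv.coe_toAddMonoidHom, Function.comp_apply, Affine.Point.congrEquiv_symm_apply_apply,
    twoIsogenyHom_apply]
  exact (W.baseChange L).twoIsogenyDualFun_twoIsogenyFun P

/-- `ker ψ_L = {Ō, T̄}`. [cite: SilvermanTate2015, §3.4 Prop. 3.7(a)] -/
theorem twoIsogenyDualPointsFun_eq_zero_iff {L : Type v} [Field L] [Algebra K L]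
    (Q : (W.twoIsogenyCodomain.baseChange L).toAffine.Point) :
    W.twoIsogenyDualPointsFun L Q = 0 ↔
      Q = 0 ∨ Q = (W.twoIsogenyCodomain.baseChange L).twoTorsionPoint := by
  rcases Q with _ | ⟨X, Y, h⟩
  · simp [← Affine.Point.zero_def]
  · by_cases hX : X = 0
    · have hY := y_eq_zero_of_x_eq_zero _ h hX
      subst hX hY
      simp only [twoIsogenyDualPointsFun_some_of_eq_zero W h rfl, true_iff]
      exact Or.inr rfl
    · obtain ⟨h', e⟩ := twoIsogenyDualPointsFun_some W h hX
      rw [e]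
      constructor
      · intro h0; exact absurd h0 (Affine.Point.some_ne_zero _)
      · rintro (h0 | h0)
        · exact absurd h0 (Affine.Point.some_ne_zero _)
        · simp only [twoTorsionPoint, Affine.Point.some.injEq] at h0
          exact absurd h0.1 hX

/-- `ker α_L = ψ_L(E₂(L))`. [cite: SilvermanTate2015, §3.5 Prop. 3.8(b)] -/
theorem xSqClass_eq_one_iff_exists_twoIsogenyDualPointsFun {L : Type v} [Field L] [Algebra K L]
    (P : (W.baseChange L).toAffine.Point) :
    (W.baseChange L).xSqClass P = 1 ↔ ∃ Q, W.twoIsogenyDualPointsFun L Q = P := by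
  rw [(W.baseChange L).xSqClass_eq_one_iff_exists_twoIsogenyDualFun P]
  constructor
  · rintro ⟨Q, hQ⟩
    refine ⟨Affine.Point.congrEquiv (twoIsogenyCodomain_baseChange W L) Q, ?_⟩
    simp only [twoIsogenyDualPointsFun, Affine.Point.congrEquiv_symm_apply_apply, hQ]
  · rintro ⟨Q, rfl⟩
    exact ⟨_, rfl⟩

/-- `ψ_L` is additive (at any `DecidableEq L`). [cite: SilvermanTate2015, §3.4 Prop. 3.7] -/
theorem twoIsogenyDualPointsFun_add {L : Type v} [Field L] [Algebra K L] [d : DecidableEq L]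
    (P Q : (W.twoIsogenyCodomain.baseChange L).toAffine.Point) :
    W.twoIsogenyDualPointsFun L (P + Q) = W.twoIsogenyDualPointsFun L P + W.twoIsogenyDualPointsFun L Q := by
  have e : d = Classical.decEq L := Subsingleton.elim _ _
  subst e
  simp only [twoIsogenyDualPointsFun, map_add, twoIsogenyDualFun_add]

/-- **The dual as a homomorphism on `L`-points** (ambient `DecidableEq L`).
[cite: SilvermanTate2015, §3.4 Prop. 3.7] -/
def twoIsogenyDualPointsHom (L : Type v) [Field L] [Algebra K L] [DecidableEq L] :
    (W.twoIsogenyCodomain.baseChange L).toAffine.Point →+ (W.baseChange L).toAffine.Point where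
  toFun := W.twoIsogenyDualPointsFun L
  map_zero' := W.twoIsogenyDualPointsFun_zero L
  map_add' := W.twoIsogenyDualPointsFun_add

/-- `twoIsogenyDualPointsHom` is `twoIsogenyDualPointsFun` as a function (the formula of the dual). [cite: SilvermanTate2015, §3.4 Prop. 3.7(b)] -/
@[simp]
theorem twoIsogenyDualPointsHom_apply (L : Type v) [Field L] [Algebra K L] [DecidableEq L]
    (Q : (W.twoIsogenyCodomain.baseChange L).toAffine.Point) :
    W.twoIsogenyDualPointsHom L Q = W.twoIsogenyDualPointsFun L Q :=
  rfl

end Extension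

end WeierstrassCurve

end
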